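/-
Copyright (c) 2026 the pub-hodgecm-mathlib formalisation cell (harness21).  Prover seat hodgecm-mathlib-B-p04 (g34) — EP PEN of (R2) (LEAD F0P3a-plan (g9)
WORD T8-167, desk F0P3-plan (g8) dedup 2026-09-01T08:07:50Z, token ruling 08:12:47Z), 2026-09-01.  FILE (R3a) of the Euler–Poincaré road for
`stub_N6nsR2EP : RankOneEulerPoincareNonsplit` (type (1) EDGE COUNT; the star counts are shared with B-p10 (g25)'s (ii) `𝟙_I` non-elliptic unfolding).
-/
import Mathlib.LinearAlgebra.Matrix.ToLinearEquiv
import Mathlib.LinearAlgebra.FiniteDimensional.Lemmas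
import Mathlib.Data.Matrix.Mul
import Mathlib.Tactic.LinearCombination
import Mathlib.Tactic.Module
import Mathlib.Tactic.FinCases
import Mathlib.Tactic.Abel
import HarnessLib

/-!
# Eigen-lines of a `τ`-unitary `2 × 2` matrix: the left-eigenvector trick, (an)isotropy of eigen-lines

Topic `NumberTheory/Automorphic`, namespace `Literature.NumberTheory.Automorphic`.  THEOREMS ONLY: no definition, no named fact, no instance, no
notation, no `sorry`; kernel lane.  Road «(R2) Euler–Poincaré» of the cell's H-side transfer programme (Rogawski 1990, Lemma 12.7.1, nonsplit half),
brick (2b) of the EP pen's census `CENSUS-R2EP-RankOneEulerPoincare.B-p04g34.md`; consumed by FILE (R3b) `UnitaryTwoResidualProjectiveLine` and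
FILE (R3c) `UnitaryTwoIwahoriStarFixedPoints` (fixed points of `k ∈ K = U(Φ₂)(𝒪)` on the Iwahori star `K ⧸ I` by reduction type).

THE MATHEMATICS.  `κ` a field with a ring endomorphism `τ` (the residual involution), `J ∈ M₂(κ)`, `M ∈ M₂(κ)` with `ᵗτ(M) J M = J` (`τ`-unitary).
For an eigenvector `M v = λ v` the ROW vector `r_v := ᵗτ(v) J` satisfies `τ(λ) • r_v M = r_v` (`map_smul_vecMul_vecMul_eq_of_mulVec_eq_smul`), so for
a norm-one eigenvalue (`τλ·λ = 1`) `r_v` is a LEFT eigenvector for the same `λ`.  Consequences (Kottwitz's local analysis of the fixed edges of an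
elliptic element on the tree of `U(1,1)`, [Kottwitz1988, §2]; [Serre1980Trees, II.1.1]):
* `dotProduct_self_ne_zero_of_eigenpair` — two eigenvectors for DISTINCT norm-one eigenvalues are `J`-anisotropic when `J` is invertible
  (`r_v` kills the other eigenvector, so it cannot kill `v`), and then NO eigen-line at all is isotropic
  (`dotProduct_self_ne_zero_of_eigenpair_of_mulVec_eq_smul`);
* `exists_isotropic_eigenvector_of_sq_eq_zero` / `exists_smul_eq_of_sq_eq_zero` — if `(M − λ)² = 0`, `M ≠ λ`, `τλ·λ = 1`, the unique `M`-stable line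
  `ker(M − λ) = im(M − λ)` is isotropic;
* `sub_smul_one_mul_self_eq_zero` — `2 × 2` Cayley–Hamilton at a double eigenvalue; `eq_zero_of_dotProduct_pair_eq_zero`,
  `linearIndependent_pair_of_eigen`, `map_comp_smul_vecMul_dotProduct_smul` (scaling of the hermitian form) are the elementary tools.
HONEST LABEL: HC_CM is proved only modulo the cell's remaining named inputs (hLiu418, h413) until rung 0 closes; this file is unconditional algebra.

## References
* [Kottwitz1988] R. E. Kottwitz, *Tamagawa numbers*, Ann. of Math. 127 (1988), 629–646, §2 (Euler–Poincaré functions; `O_γ(f_EP) = χ(X^γ)`).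
* [Serre1980Trees] J.-P. Serre, *Trees* (1980), Ch. II §1.1 (the tree of `SL₂` over a local field; the star of a vertex = `ℙ¹` of the residue field).
* [Rogawski1990] J. D. Rogawski, *Automorphic Representations of Unitary Groups in Three Variables* (1990), §12.6–12.7 pp. 174–176 (Lemma 12.7.1).
* [IwahoriMatsumoto1965] N. Iwahori, H. Matsumoto, Publ. Math. IHÉS 25 (1965), §2 (Iwahori subgroup = preimage of the Borel under reduction).
* [Serre1979] J.-P. Serre, *Local Fields*, GTM 67 (1979), Ch. V §2 Prop. 2–3 (unramified quadratic extensions: trace and fixed points).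
-/

set_option autoImplicit false

open scoped Matrix
open Matrix

namespace Literature.NumberTheory.Automorphic

/-! ## §1 Eigen-lines of a `τ`-unitary `2 × 2` matrix over a field -/

section Field

variable {κ : Type*} [Field κ] (τ : κ →+* κ)

/-- **The left eigenvector of an eigenvector.** If `ᵗτ(M) J M = J` and `M v = λ v` then the row vector `r_v := ᵗτ(v) J` satisfies
`τ(λ) • (r_v M) = r_v` (apply `ᵗτ(v)` to the unitarity identity). [cite: Kottwitz1988, §2] -/
theorem map_smul_vecMul_vecMul_eq_of_mulVec_eq_smul {J M : Matrix (Fin 2) (Fin 2) κ} (hM : (M.map τ)ᵀ * J * M = J)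
    {v : Fin 2 → κ} {l : κ} (hv : M *ᵥ v = l • v) :
    τ l • (((τ ∘ v) ᵥ* J) ᵥ* M) = (τ ∘ v) ᵥ* J := by
  have h1 : (τ ∘ v) ᵥ* (M.map τ)ᵀ = τ l • (τ ∘ v) := by
    rw [vecMul_transpose]
    funext i
    rw [← RingHom.map_mulVec τ M v i, hv, Pi.smul_apply, Pi.smul_apply, smul_eq_mul, smul_eq_mul, map_mul]
    rfl
  calc τ l • (((τ ∘ v) ᵥ* J) ᵥ* M) = (((τ ∘ v) ᵥ* (M.map τ)ᵀ) ᵥ* J) ᵥ* M := by rw [h1, smul_vecMul, smul_vecMul]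
    _ = (τ ∘ v) ᵥ* ((M.map τ)ᵀ * J * M) := by rw [vecMul_vecMul, vecMul_vecMul, Matrix.mul_assoc]
    _ = (τ ∘ v) ᵥ* J := by rw [hM]

/-- For a NORM-ONE eigenvalue (`τ(λ) λ = 1`) the left eigenvector has the same eigenvalue: `r_v M = λ • r_v`. [cite: Kottwitz1988, §2] -/
theorem vecMul_vecMul_eq_smul_of_mulVec_eq_smul {J M : Matrix (Fin 2) (Fin 2) κ} (hM : (M.map τ)ᵀ * J * M = J)
    {v : Fin 2 → κ} {l : κ} (hv : M *ᵥ v = l • v) (hl : τ l * l = 1) :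
    ((τ ∘ v) ᵥ* J) ᵥ* M = l • ((τ ∘ v) ᵥ* J) := by
  have h := congrArg (fun r => l • r) (map_smul_vecMul_vecMul_eq_of_mulVec_eq_smul τ hM hv)
  simp only [smul_smul] at h
  rwa [mul_comm, hl, one_smul] at h

/-- A row vector orthogonal to two linearly independent vectors of `κ²` vanishes (rank–nullity in dimension `2`). [cite: HornJohnson2013, §0.4.4] -/
theorem eq_zero_of_dotProduct_pair_eq_zero {r v w : Fin 2 → κ} (hvw : LinearIndependent κ ![v, w]) (hv : r ⬝ᵥ v = 0) (hw : r ⬝ᵥ w = 0) :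
    r = 0 := by
  -- `det [v w] ≠ 0`
  have hdet : v 0 * w 1 - v 1 * w 0 ≠ 0 := by
    intro h
    have h1 := (LinearIndependent.pair_iff.1 hvw) (w 1) (-(v 1)) (by
      funext i; fin_cases i
      · simp only [Fin.zero_eta, Pi.add_apply, Pi.smul_apply, smul_eq_mul, Pi.zero_apply, Fin.isValue]; linear_combination h
      · simp only [Fin.mk_one, Pi.add_apply, Pi.smul_apply, smul_eq_mul, Pi.zero_apply, Fin.isValue]; ring)
    obtain ⟨hw1, hv1⟩ := h1
    have hv1' : v 1 = 0 := neg_eq_zero.1 hv1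
    have h2 := (LinearIndependent.pair_iff.1 hvw) (w 0) (-(v 0)) (by
      funext i; fin_cases i
      · simp only [Fin.zero_eta, Pi.add_apply, Pi.smul_apply, smul_eq_mul, Pi.zero_apply, Fin.isValue]; ring
      · simp only [Fin.mk_one, Pi.add_apply, Pi.smul_apply, smul_eq_mul, Pi.zero_apply, Fin.isValue]; rw [hw1, hv1']; ring)
    obtain ⟨hw0, hv0⟩ := h2
    have hv0' : v 0 = 0 := neg_eq_zero.1 hv0
    have hvz : v = 0 := by funext i; fin_cases i <;> simp [hv0', hv1']
    exact LinearIndependent.ne_zero 0 hvw (by simpa using hvz)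
  have e0 : r 0 * v 0 + r 1 * v 1 = 0 := by simpa [dotProduct, Fin.sum_univ_two] using hv
  have e1 : r 0 * w 0 + r 1 * w 1 = 0 := by simpa [dotProduct, Fin.sum_univ_two] using hw
  have hr0 : r 0 * (v 0 * w 1 - v 1 * w 0) = 0 := by linear_combination (w 1) * e0 - (v 1) * e1
  have hr1 : r 1 * (v 0 * w 1 - v 1 * w 0) = 0 := by linear_combination (-(w 0)) * e0 + (v 0) * e1
  funext i; fin_cases i
  · exact (mul_eq_zero.1 hr0).resolve_right hdet
  · exact (mul_eq_zero.1 hr1).resolve_right hdet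

/-- Eigenvectors of a `2 × 2` matrix for two distinct eigenvalues are linearly independent. [cite: HornJohnson2013, Lemma 1.3.8] -/
theorem linearIndependent_pair_of_eigen {M : Matrix (Fin 2) (Fin 2) κ} {v w : Fin 2 → κ} {l m : κ} (hv : M *ᵥ v = l • v) (hw : M *ᵥ w = m • w)
    (hv0 : v ≠ 0) (hw0 : w ≠ 0) (hlm : l ≠ m) : LinearIndependent κ ![v, w] := by
  refine LinearIndependent.pair_iff.2 fun s t hst => ?_
  -- apply `M`: `s l v + t m w = 0`; subtract `m •`: `s (l - m) v = 0`
  have h1 : M *ᵥ (s • v + t • w) = 0 := by rw [hst, mulVec_zero]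
  rw [mulVec_add, mulVec_smul, mulVec_smul, hv, hw, smul_smul, smul_smul] at h1
  have h2 : (s * (l - m)) • v = 0 := by
    calc (s * (l - m)) • v = ((s * l) • v + (t * m) • w) - m • (s • v + t • w) := by module
      _ = 0 := by rw [h1, hst, smul_zero, sub_zero]
  have hs : s = 0 := by
    rcases smul_eq_zero.1 h2 with h | h
    · exact (mul_eq_zero.1 h).resolve_right (sub_ne_zero.2 hlm)
    · exact absurd h hv0
  rw [hs, zero_smul, zero_add] at hst
  exact ⟨hs, (smul_eq_zero.1 hst).resolve_right hw0⟩

/-- **Distinct norm-one eigenvalues ⇒ anisotropic eigenvectors.** For `ᵗτ(M) J M = J` with `J` invertible and eigenvectors `v, w ≠ 0`,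
`M v = λ v`, `M w = μ w`, `λ ≠ μ`, `τλ·λ = τμ·μ = 1`: `ᵗτ(v) J v ≠ 0` (the left eigenvector `r_v` kills `w` — `(λ − μ) r_v w = 0` — so it cannot
also kill `v`). [cite: Kottwitz1988, §2] -/
theorem dotProduct_self_ne_zero_of_eigenpair {J M : Matrix (Fin 2) (Fin 2) κ} (hJ : IsUnit J.det) (hM : (M.map τ)ᵀ * J * M = J)
    {v w : Fin 2 → κ} {l m : κ} (hv : M *ᵥ v = l • v) (hw : M *ᵥ w = m • w) (hv0 : v ≠ 0) (hw0 : w ≠ 0) (hlm : l ≠ m)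
    (hl : τ l * l = 1) : ((τ ∘ v) ᵥ* J) ⬝ᵥ v ≠ 0 := by
  intro hvv
  have hr := vecMul_vecMul_eq_smul_of_mulVec_eq_smul τ hM hv hl
  -- `r_v ⬝ w = 0`
  have hrw : ((τ ∘ v) ᵥ* J) ⬝ᵥ w = 0 := by
    have h1 : ((τ ∘ v) ᵥ* J) ⬝ᵥ (M *ᵥ w) = l * (((τ ∘ v) ᵥ* J) ⬝ᵥ w) := by
      rw [dotProduct_mulVec, hr, smul_dotProduct, smul_eq_mul]
    rw [hw, dotProduct_smul, smul_eq_mul] at h1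
    have h2 : (l - m) * (((τ ∘ v) ᵥ* J) ⬝ᵥ w) = 0 := by linear_combination -h1
    exact (mul_eq_zero.1 h2).resolve_left (sub_ne_zero.2 hlm)
  have hr0 : (τ ∘ v) ᵥ* J = 0 := eq_zero_of_dotProduct_pair_eq_zero (linearIndependent_pair_of_eigen hv hw hv0 hw0 hlm) hvv hrw
  -- `J` invertible ⇒ `τ ∘ v = 0` ⇒ `v = 0`
  have hτv : τ ∘ v = 0 := by
    have := congrArg (fun r => r ᵥ* J⁻¹) hr0
    simpa only [vecMul_vecMul, mul_nonsing_inv J hJ, vecMul_one, zero_vecMul] using this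
  apply hv0
  funext i
  have hi := congrFun hτv i
  simp only [Function.comp_apply, Pi.zero_apply, map_eq_zero] at hi
  exact hi

/-- **An isotropic eigen-line forces a repeated eigenvalue.** Under the hypotheses of `dotProduct_self_ne_zero_of_eigenpair`, NO non-zero vector
`x` with `M x ∈ κ x` is isotropic: `x` is a multiple of `v` or of `w`. [cite: Kottwitz1988, §2] -/
theorem dotProduct_self_ne_zero_of_eigenpair_of_mulVec_eq_smul {J M : Matrix (Fin 2) (Fin 2) κ} (hJ : IsUnit J.det)
    (hM : (M.map τ)ᵀ * J * M = J) {v w : Fin 2 → κ} {l m : κ} (hv : M *ᵥ v = l • v) (hw : M *ᵥ w = m • w) (hv0 : v ≠ 0) (hw0 : w ≠ 0)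
    (hlm : l ≠ m) (hl : τ l * l = 1) (hm : τ m * m = 1) {x : Fin 2 → κ} (hx0 : x ≠ 0) {n : κ} (hx : M *ᵥ x = n • x) :
    ((τ ∘ x) ᵥ* J) ⬝ᵥ x ≠ 0 := by
  have hind := linearIndependent_pair_of_eigen hv hw hv0 hw0 hlm
  -- `x = a v + b w`
  have htop : Submodule.span κ (Set.range ![v, w]) = ⊤ :=
    hind.span_eq_top_of_card_eq_finrank' (by simp)
  have hxmem : x ∈ Submodule.span κ (Set.range ![v, w]) := by rw [htop]; exact Submodule.mem_top
  rw [Matrix.range_cons, Matrix.range_cons, Matrix.range_empty, Set.union_empty, ← Set.insert_eq, Submodule.mem_span_pair] at hxmem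
  obtain ⟨a, b, rfl⟩ := hxmem
  -- `M x = n x` ⇒ `a (l - n) = 0`, `b (m - n) = 0`
  have h1 : (a * (l - n)) • v + (b * (m - n)) • w = 0 := by
    have h := hx
    rw [mulVec_add, mulVec_smul, mulVec_smul, hv, hw, smul_smul, smul_smul, smul_add, smul_smul, smul_smul] at h
    calc (a * (l - n)) • v + (b * (m - n)) • w = ((a * l) • v + (b * m) • w) - ((n * a) • v + (n * b) • w) := by module
      _ = 0 := by rw [h, sub_self]
  obtain ⟨ha, hb⟩ := (LinearIndependent.pair_iff.1 hind) _ _ h1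
  -- scaling: `ᵗτ(c y) J (c y) = τ c · c · ᵗτ(y) J y`
  have hscale : ∀ (c : κ) (y : Fin 2 → κ), ((τ ∘ (c • y)) ᵥ* J) ⬝ᵥ (c • y) = (τ c * c) * (((τ ∘ y) ᵥ* J) ⬝ᵥ y) := by
    intro c y
    have : τ ∘ (c • y) = τ c • (τ ∘ y) := by funext i; simp [map_mul]
    rw [this, smul_vecMul, smul_dotProduct, dotProduct_smul, smul_eq_mul, smul_eq_mul, mul_assoc]
  rcases mul_eq_zero.1 ha with ha0 | hln
  · -- `a = 0`: `x = b w`, `b ≠ 0`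
    subst ha0
    have hb0 : b ≠ 0 := by rintro rfl; exact hx0 (by simp)
    rw [zero_smul, zero_add, hscale]
    exact mul_ne_zero (mul_ne_zero (by rwa [map_ne_zero]) hb0) (dotProduct_self_ne_zero_of_eigenpair τ hJ hM hw hv hw0 hv0 hlm.symm hm)
  · -- `l = n` ⇒ `b (m - l) = 0` ⇒ `b = 0`
    have hn : n = l := (sub_eq_zero.1 hln).symm
    subst hn
    have hb0 : b = 0 := (mul_eq_zero.1 hb).resolve_right (sub_ne_zero.2 hlm.symm)
    subst hb0
    have ha0 : a ≠ 0 := by rintro rfl; exact hx0 (by simp)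
    rw [zero_smul, add_zero, hscale]
    exact mul_ne_zero (mul_ne_zero (by rwa [map_ne_zero]) ha0) (dotProduct_self_ne_zero_of_eigenpair τ hJ hM hv hw hv0 hw0 hlm hl)

/-- **Double eigenvalue, non-scalar ⇒ an isotropic eigenvector.** If `ᵗτ(M) J M = J`, `(M − λ)² = 0`, `M ≠ λ` and `τλ·λ = 1`, then some `v ≠ 0` has
`M v = λ v` and `ᵗτ(v) J v = 0`: take `v = (M − λ) y ≠ 0`; `r_v (M − λ) = 0` gives `r_v v = 0`. [cite: Kottwitz1988, §2] -/
theorem exists_isotropic_eigenvector_of_sq_eq_zero {J M : Matrix (Fin 2) (Fin 2) κ} (hM : (M.map τ)ᵀ * J * M = J) {l : κ}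
    (hsq : (M - l • (1 : Matrix (Fin 2) (Fin 2) κ)) * (M - l • 1) = 0) (hne : M ≠ l • 1) (hl : τ l * l = 1) :
    ∃ v : Fin 2 → κ, v ≠ 0 ∧ M *ᵥ v = l • v ∧ ((τ ∘ v) ᵥ* J) ⬝ᵥ v = 0 := by
  -- a vector not killed by `M - l`
  obtain ⟨y, hy⟩ : ∃ y : Fin 2 → κ, (M - l • 1) *ᵥ y ≠ 0 := by
    by_contra! h
    apply hne
    rw [← sub_eq_zero]
    ext i j
    have := congrFun (h (Pi.single j 1)) i
    rwa [mulVec_single_one, Pi.zero_apply] at this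
  refine ⟨(M - l • 1) *ᵥ y, hy, ?_, ?_⟩
  · -- `M v = l v` since `(M - l) v = (M - l)² y = 0`
    have h0 : (M - l • 1) *ᵥ ((M - l • 1) *ᵥ y) = 0 := by rw [mulVec_mulVec, hsq, zero_mulVec]
    rw [sub_mulVec, sub_eq_zero, smul_mulVec, one_mulVec] at h0
    exact h0
  · -- `r_v (M - l) = 0`
    have h0 : (M - l • 1) *ᵥ ((M - l • 1) *ᵥ y) = 0 := by rw [mulVec_mulVec, hsq, zero_mulVec]
    have hv : M *ᵥ ((M - l • 1) *ᵥ y) = l • ((M - l • 1) *ᵥ y) := by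
      rw [sub_mulVec, sub_eq_zero, smul_mulVec, one_mulVec] at h0; exact h0
    have hr := vecMul_vecMul_eq_smul_of_mulVec_eq_smul τ hM hv hl
    have hr0 : ((τ ∘ ((M - l • 1) *ᵥ y)) ᵥ* J) ᵥ* (M - l • 1) = 0 := by
      rw [vecMul_sub, hr, vecMul_smul, vecMul_one, sub_self]
    rw [dotProduct_mulVec, hr0, zero_dotProduct]

/-- **Double eigenvalue, non-scalar ⇒ the stable line is unique.** If `(M − λ)² = 0`, `M ≠ λ`, `v ≠ 0` with `M v = λ v`, then every `x ≠ 0`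
with `M x = ν x` is a multiple of `v` (`ν = λ`, and `ker(M − λ)` is a line: the Jordan block `J₂(λ)` has a single eigen-line). [cite: HornJohnson2013, §3.1] -/
theorem exists_smul_eq_of_sq_eq_zero {M : Matrix (Fin 2) (Fin 2) κ} {l : κ} (hsq : (M - l • (1 : Matrix (Fin 2) (Fin 2) κ)) * (M - l • 1) = 0)
    (hne : M ≠ l • 1) {v : Fin 2 → κ} (hv0 : v ≠ 0) (hv : M *ᵥ v = l • v) {x : Fin 2 → κ} (hx0 : x ≠ 0) {n : κ}
    (hx : M *ᵥ x = n • x) : ∃ a : κ, a • v = x := by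
  -- `n = l`
  have hnl : n = l := by
    have h1 : (M - l • 1) *ᵥ x = (n - l) • x := by rw [sub_mulVec, hx, smul_mulVec, one_mulVec, sub_smul]
    have h2 : (M - l • 1) *ᵥ ((M - l • 1) *ᵥ x) = 0 := by rw [mulVec_mulVec, hsq, zero_mulVec]
    rw [h1, mulVec_smul, h1, smul_smul] at h2
    rcases smul_eq_zero.1 h2 with h | h
    · exact (sub_eq_zero.1 (mul_self_eq_zero.1 h))
    · exact absurd h hx0
  subst hnl
  -- if `v, x` were independent, `M - n` would kill a basis
  by_contra hax
  have hind : LinearIndependent κ ![v, x] := by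
    refine LinearIndependent.pair_iff.2 fun s t hst => ?_
    by_cases ht : t = 0
    · subst ht
      rw [zero_smul, add_zero] at hst
      exact ⟨(smul_eq_zero.1 hst).resolve_right hv0, rfl⟩
    · exfalso
      apply hax
      refine ⟨-(s / t), ?_⟩
      have : x = -(s / t) • v := by
        have h := congrArg (fun y => t⁻¹ • y) hst
        simp only [smul_add, smul_smul, inv_mul_cancel₀ ht, one_smul, smul_zero] at h
        calc x = (t⁻¹ * s) • v + x - (t⁻¹ * s) • v := by abel
          _ = -(s / t) • v := by rw [h, zero_sub, div_eq_inv_mul, neg_smul]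
      exact this.symm
  have htop : Submodule.span κ (Set.range ![v, x]) = ⊤ := hind.span_eq_top_of_card_eq_finrank' (by simp)
  apply hne
  rw [← sub_eq_zero]
  have hker : ∀ y : Fin 2 → κ, (M - n • 1) *ᵥ y = 0 := by
    intro y
    have hy : y ∈ Submodule.span κ (Set.range ![v, x]) := by rw [htop]; exact Submodule.mem_top
    rw [Matrix.range_cons, Matrix.range_cons, Matrix.range_empty, Set.union_empty, ← Set.insert_eq, Submodule.mem_span_pair] at hy
    obtain ⟨a, b, rfl⟩ := hy
    rw [mulVec_add, mulVec_smul, mulVec_smul, sub_mulVec, sub_mulVec, hv, hx, smul_mulVec, one_mulVec, smul_mulVec, one_mulVec,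
      sub_self, sub_self, smul_zero, smul_zero, add_zero]
  ext i j
  have := congrFun (hker (Pi.single j 1)) i
  rwa [mulVec_single_one, Pi.zero_apply] at this

/-- Scaling of the sesquilinear form: `ᵗτ(c y) J (c y) = τ(c) c · ᵗτ(y) J y`. [cite: BourbakiAlgebreIX2007, §1 no. 1] -/
theorem map_comp_smul_vecMul_dotProduct_smul (J : Matrix (Fin 2) (Fin 2) κ) (c : κ) (y : Fin 2 → κ) :
    ((τ ∘ (c • y)) ᵥ* J) ⬝ᵥ (c • y) = (τ c * c) * (((τ ∘ y) ᵥ* J) ⬝ᵥ y) := by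
  have : τ ∘ (c • y) = τ c • (τ ∘ y) := by funext i; simp [map_mul]
  rw [this, smul_vecMul, smul_dotProduct, dotProduct_smul, smul_eq_mul, smul_eq_mul, mul_assoc]

/-- `2 × 2` Cayley–Hamilton at a double eigenvalue: `tr M = 2λ`, `det M = λ²` ⇒ `(M − λ)² = 0`. [cite: HornJohnson2013, Thm. 2.4.3.2 (Cayley–Hamilton)] -/
theorem sub_smul_one_mul_self_eq_zero {R : Type*} [CommRing R] {M : Matrix (Fin 2) (Fin 2) R} {l : R} (htr : M 0 0 + M 1 1 = l + l)
    (hdet : M 0 0 * M 1 1 - M 0 1 * M 1 0 = l * l) : (M - l • (1 : Matrix (Fin 2) (Fin 2) R)) * (M - l • 1) = 0 := by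
  ext i j
  fin_cases i <;> fin_cases j <;> simp [Matrix.mul_apply, Fin.sum_univ_two, one_apply]
  · linear_combination (M 0 0) * htr - hdet
  · linear_combination (M 0 1) * htr
  · linear_combination (M 1 0) * htr
  · linear_combination (M 1 1) * htr - hdet

end Field

end Literature.NumberTheory.Automorphic
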